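import Summits.ResolutionOfSingularities.ResolutionOfSingularities.Theorems.WildConesClassicalRegimesStubMuDropCharTwoOrdPReduction

/-!
# Milnor drop in characteristic two (`stub_muDropCharTwoOrdP`) — helper 4/8: Descent

Helper file for the stub `stub_muDropCharTwoOrdP` of crux `ClassicalRegimes`
(stmt-ResolutionOfSingularities-16884, route `WildCones`, line `milnor-descent`): the one-step drop
of the Milnor number `μ = dim_κ κ⟦u₁,…,uₙ⟧/(∂a)` of the cleaned state of `z² = a(u)` under the
point-blow-up dynamics in characteristic two, `n ≥ 3`. The proof works on formal power series:
a hyperbolic pair `u_j u_l` of the quadratic part of `a` is split off by the formal coordinate change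
`u_j ↦ q⁻¹ ∂_l a, u_l ↦ q⁻¹ ∂_j a` (formal inverse function theorem; `∂_j ∂_j = 0` in
characteristic two makes `∂_j ã ∈ (u_l)`, `∂_l ã ∈ (u_j)`), which commutes with the strict
transform; killing `u_j, u_l` descends to `n - 2` variables with the same Milnor algebras. The
leaves: `n ≥ 3` residual variables without hyperbolic pair are not isolated (Case A), `n = 1` is
`μ = ord - 1`, and `n = 2` is Max Noether's inequality `I(∂ₓa, ∂_y a) ≥ m m' + I(strict transforms)`
at the point of the exceptional line plus the multiplicity `≤ 3` of that line in `(∂G)`.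
Sources: G.-M. Greuel, G. Pfister, *The splitting lemma in any characteristic*, J. Algebra 689
(2026) = arXiv:2507.17078, Thm. 3.5 / Cor. 3.7 (the hyperbolic pair; only its linear part is used);
E. Casas-Alvero, *Singularities of Plane Curves*, §3 (Noether's formula); folklore otherwise.

This file: killing the pair of variables (`MvPowerSeries.killCompl`): kernel, surjectivity, compatibility with partial derivatives and substitutions, the isomorphism of Milnor algebras `κ⟦X⟧/(∂f) ≅ κ⟦X''⟧/(∂ f̃|)`, and the full descent step (the strict transform commutes with the reduction).
-/

noncomputable section

-- single-problem summit: the doubled namespace component `ResolutionOfSingularities` is forced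
set_option linter.dupNamespace false

open scoped BigOperators Classical

open MvPowerSeries IsLocalRing

open Literature.AlgebraicGeometry.Resolution

namespace Summit.ResolutionOfSingularities.ResolutionOfSingularities.Theorems.WildCones

namespace MuDropCharTwoOrdP

variable {κ : Type} [Field κ]

/-! ## Killing the pair of variables: descent to `n - 2` variables -/

section Descent

variable {n m : ℕ}

/-- Killing variables commutes with the surviving partial derivatives. [folklore] -/
theorem killCompl_pderiv (e : Fin m ↪ Fin n) (t : Fin m) (g : MvPowerSeries (Fin n) κ) :
    killCompl e (MvPowerSeries.pderiv (e t) g) = MvPowerSeries.pderiv t (killCompl e g) := by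
  ext x
  rw [coeff_killCompl, MvPowerSeries.coeff_pderiv, MvPowerSeries.coeff_pderiv, coeff_killCompl,
    Finsupp.embDomain_add, Finsupp.embDomain_single, Finsupp.embDomain_apply_self]

/-- Killing variables does not change the constant coefficient. [folklore] -/
theorem constantCoeff_killCompl (e : Fin m ↪ Fin n) (g : MvPowerSeries (Fin n) κ) :
    constantCoeff (killCompl e g) = constantCoeff g := by
  rw [← coeff_zero_eq_constantCoeff_apply, coeff_killCompl, Finsupp.embDomain_zero,
    coeff_zero_eq_constantCoeff_apply]

/-- Linear coefficients after killing variables. [folklore] -/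
theorem coeff_single_killCompl (e : Fin m ↪ Fin n) (t : Fin m) (g : MvPowerSeries (Fin n) κ) :
    coeff (Finsupp.single t 1) (killCompl e g) = coeff (Finsupp.single (e t) 1) g := by
  rw [coeff_killCompl, Finsupp.embDomain_single]

/-- Killing variables preserves `ord ≥ 2`. [folklore] -/
theorem two_le_order_killCompl (e : Fin m ↪ Fin n) {g : MvPowerSeries (Fin n) κ}
    (hg : 2 ≤ g.order) : 2 ≤ (killCompl e g).order := by
  rw [FormalCoordChange.two_le_order_iff] at hg ⊢
  exact ⟨by rw [constantCoeff_killCompl]; exact hg.1, fun t => by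
    rw [coeff_single_killCompl]; exact hg.2 _⟩

/-- Killing variables commutes with substitution. [folklore] -/
theorem killCompl_subst (e : Fin m ↪ Fin n) {a : Fin n → MvPowerSeries (Fin n) κ}
    (ha : ∀ s, constantCoeff (a s) = 0) (f : MvPowerSeries (Fin n) κ) :
    killCompl e (subst a f) = subst (fun s => killCompl e (a s)) f := by
  have ha' : HasSubst a := hasSubst_of_constantCoeff_zero ha
  have hb : HasSubst (fun s => killCompl e (a s)) :=
    hasSubst_of_constantCoeff_zero fun s => by rw [constantCoeff_killCompl]; exact ha s
  ext x
  rw [coeff_killCompl, coeff_subst ha', coeff_subst hb]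
  refine finsum_congr fun d => ?_
  rw [← coeff_killCompl, map_finsuppProd]
  simp only [map_pow]

/-- The kernel of killing `X_j, X_l` is contained in `(X_j, X_l)`. [folklore] -/
theorem ker_killCompl_le (e : Fin m ↪ Fin n) {j l : Fin n}
    (he : ∀ s, s ∈ Set.range e ↔ s ≠ j ∧ s ≠ l) :
    RingHom.ker (killCompl (R := κ) e : MvPowerSeries (Fin n) κ →+* MvPowerSeries (Fin m) κ) ≤
      Ideal.span {(X j : MvPowerSeries (Fin n) κ), X l} := by
  intro g hg
  rw [RingHom.mem_ker] at hg
  change killCompl e g = 0 at hg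
  -- `g₁` : the part of `g` free of `X_j`
  let g₁ : MvPowerSeries (Fin n) κ := fun A => if A j = 0 then coeff A g else 0
  have h1 : (X j : MvPowerSeries (Fin n) κ) ∣ g - g₁ := by
    rw [X_dvd_iff]
    intro A hA
    rw [map_sub, show coeff A g₁ = if A j = 0 then coeff A g else 0 from rfl, if_pos hA, sub_self]
  have h2 : (X l : MvPowerSeries (Fin n) κ) ∣ g₁ := by
    rw [X_dvd_iff]
    intro A hAl
    rw [show coeff A g₁ = if A j = 0 then coeff A g else 0 from rfl]
    split_ifs with hAj
    · have hsupp : ((A.support : Finset (Fin n)) : Set (Fin n)) ⊆ Set.range e := by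
        intro s hs
        rw [Finset.mem_coe, Finsupp.mem_support_iff] at hs
        rw [he]
        exact ⟨fun h => hs (h ▸ hAj), fun h => hs (h ▸ hAl)⟩
      have hA := Finsupp.embDomain_comapDomain (f := e) hsupp
      have := congrArg (coeff (A.comapDomain e e.injective.injOn)) hg
      rwa [coeff_killCompl, hA, map_zero] at this
    · rfl
  have : g = (g - g₁) + g₁ := by ring
  rw [this]
  obtain ⟨w1, hw1⟩ := h1
  obtain ⟨w2, hw2⟩ := h2
  rw [hw1, hw2]
  exact Ideal.add_mem _ (Ideal.mul_mem_right _ _ (Ideal.subset_span (by simp)))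
    (Ideal.mul_mem_right _ _ (Ideal.subset_span (by simp)))

/-- Surjectivity of killing variables. [folklore] -/
theorem killCompl_surjective (e : Fin m ↪ Fin n) :
    Function.Surjective (killCompl (R := κ) e : MvPowerSeries (Fin n) κ → MvPowerSeries (Fin m) κ) :=
  fun g => ⟨rename e g, killCompl_rename_app g⟩

/-- The Jacobian ideal after killing `X_j, X_l`, when `X_l ∣ ∂_j g` and `X_j ∣ ∂_l g`. [folklore] -/
theorem map_killCompl_jac (e : Fin m ↪ Fin n) {j l : Fin n}
    (he : ∀ s, s ∈ Set.range e ↔ s ≠ j ∧ s ≠ l) {g : MvPowerSeries (Fin n) κ}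
    (hj : (X l : MvPowerSeries (Fin n) κ) ∣ MvPowerSeries.pderiv j g)
    (hl : (X j : MvPowerSeries (Fin n) κ) ∣ MvPowerSeries.pderiv l g) :
    (Ideal.span (Set.range fun s => MvPowerSeries.pderiv s g)).map
        (killCompl (R := κ) e : MvPowerSeries (Fin n) κ →+* MvPowerSeries (Fin m) κ) =
      Ideal.span (Set.range fun t => MvPowerSeries.pderiv t (killCompl e g)) := by
  have hKj : killCompl (R := κ) e (X j) = 0 :=
    killCompl_X_eq_zero fun h => ((he j).mp h).1 rfl
  have hKl : killCompl (R := κ) e (X l) = 0 :=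
    killCompl_X_eq_zero fun h => ((he l).mp h).2 rfl
  rw [Ideal.map_span, ← Set.range_comp]
  apply le_antisymm
  · rw [Ideal.span_le]
    rintro _ ⟨s, rfl⟩
    show killCompl e (MvPowerSeries.pderiv s g) ∈ _
    by_cases hs : s ∈ Set.range e
    · obtain ⟨t, rfl⟩ := hs
      rw [killCompl_pderiv]
      exact Ideal.subset_span ⟨t, rfl⟩
    · rw [he, not_and_or, not_not, not_not] at hs
      rcases hs with rfl | rfl
      · obtain ⟨w, hw⟩ := hj
        rw [hw, map_mul, hKl, zero_mul]
        exact Ideal.zero_mem _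
      · obtain ⟨w, hw⟩ := hl
        rw [hw, map_mul, hKj, zero_mul]
        exact Ideal.zero_mem _
  · rw [Ideal.span_le]
    rintro _ ⟨t, rfl⟩
    show MvPowerSeries.pderiv t (killCompl e g) ∈ _
    rw [← killCompl_pderiv]
    exact Ideal.subset_span ⟨e t, rfl⟩

/-- **DESCENT.** Under the conclusions of `pair_reduction`, the Milnor algebra of `f` in `n`
variables is that of `f̃(X_j = X_l = 0)` in `n - 2` variables. [folklore] -/
theorem descent (e : Fin m ↪ Fin n) {j l : Fin n} (he : ∀ s, s ∈ Set.range e ↔ s ≠ j ∧ s ≠ l)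
    {f : MvPowerSeries (Fin n) κ} (F : MvPowerSeries (Fin n) κ ≃ₐ[κ] MvPowerSeries (Fin n) κ)
    (hJ : Ideal.span (Set.range fun s => MvPowerSeries.pderiv s f) =
      (Ideal.span (Set.range fun s => MvPowerSeries.pderiv s (F.symm f))).map
        (F : MvPowerSeries (Fin n) κ →+* MvPowerSeries (Fin n) κ))
    (hj : (X l : MvPowerSeries (Fin n) κ) ∣ MvPowerSeries.pderiv j (F.symm f))
    (hl : (X j : MvPowerSeries (Fin n) κ) ∣ MvPowerSeries.pderiv l (F.symm f))
    (hXj : X j ∈ Ideal.span (Set.range fun s => MvPowerSeries.pderiv s (F.symm f)))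
    (hXl : X l ∈ Ideal.span (Set.range fun s => MvPowerSeries.pderiv s (F.symm f))) :
    Nonempty ((MvPowerSeries (Fin n) κ ⧸ Ideal.span (Set.range fun s => MvPowerSeries.pderiv s f)) ≃ₐ[κ]
      (MvPowerSeries (Fin m) κ ⧸ Ideal.span (Set.range fun t =>
        MvPowerSeries.pderiv t (killCompl e (F.symm f))))) := by
  have h1 : (MvPowerSeries (Fin n) κ ⧸ Ideal.span (Set.range fun s =>
      MvPowerSeries.pderiv s (F.symm f))) ≃ₐ[κ] (MvPowerSeries (Fin n) κ ⧸
      Ideal.span (Set.range fun s => MvPowerSeries.pderiv s f)) :=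
    Ideal.quotientEquivAlg (Ideal.span (Set.range fun s => MvPowerSeries.pderiv s (F.symm f)))
      (Ideal.span (Set.range fun s => MvPowerSeries.pderiv s f)) F hJ
  have hker : RingHom.ker (killCompl (R := κ) e : MvPowerSeries (Fin n) κ →+* MvPowerSeries (Fin m) κ) ≤
      Ideal.span (Set.range fun s => MvPowerSeries.pderiv s (F.symm f)) := by
    refine (ker_killCompl_le e he).trans ?_
    rw [Ideal.span_le]
    intro x hx
    simp only [Set.mem_insert_iff, Set.mem_singleton_iff] at hx
    rcases hx with rfl | rfl
    · exact hXj
    · exact hXl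
  obtain ⟨h2⟩ := @exists_quot_equiv_of_surjective κ _ (MvPowerSeries (Fin n) κ)
    (MvPowerSeries (Fin m) κ) _ _ _ _ (killCompl (R := κ) e) (killCompl_surjective e)
    (Ideal.span (Set.range fun s => MvPowerSeries.pderiv s (F.symm f))) hker
  have h3 : (MvPowerSeries (Fin m) κ ⧸ (Ideal.span (Set.range fun s =>
      MvPowerSeries.pderiv s (F.symm f))).map (killCompl (R := κ) e : MvPowerSeries (Fin n) κ →+*
        MvPowerSeries (Fin m) κ)) ≃ₐ[κ] (MvPowerSeries (Fin m) κ ⧸ Ideal.span (Set.range fun t =>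
        MvPowerSeries.pderiv t (killCompl e (F.symm f)))) :=
    Ideal.quotientEquivAlgOfEq κ (map_killCompl_jac e he hj hl)
  exact ⟨(h1.symm.trans h2).trans h3⟩

end Descent


/-! ## One step of the descent: the strict transform commutes with the reduction -/

section Step

variable {n m : ℕ}

/-- Substituting the extension-by-zero of a family `b` along `e` is substituting `b` after
killing the complementary variables. [folklore] -/
theorem subst_extend_eq_subst_killCompl (e : Fin m ↪ Fin n) {j l : Fin n}
    (he : ∀ s, s ∈ Set.range e ↔ s ≠ j ∧ s ≠ l) (b : Fin m → MvPowerSeries (Fin m) κ)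
    (hb : ∀ t, constantCoeff (b t) = 0) (g : MvPowerSeries (Fin n) κ) :
    subst (Function.extend e b 0) g = subst b (killCompl e g) := by
  have hb'v : ∀ s, constantCoeff (Function.extend e b 0 s) = 0 := by
    intro s
    by_cases hs : ∃ t, e t = s
    · obtain ⟨t, rfl⟩ := hs
      rw [e.injective.extend_apply]; exact hb t
    · rw [Function.extend_apply' _ _ _ hs]; simp
  have hb' : HasSubst (Function.extend e b 0) := hasSubst_of_constantCoeff_zero hb'v
  have hbs : HasSubst b := hasSubst_of_constantCoeff_zero hb
  have hj : Function.extend e b 0 j = 0 := by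
    rw [Function.extend_apply' _ _ _ (fun ⟨t, ht⟩ => ((he j).mp ⟨t, ht⟩).1 rfl)]; rfl
  have hl : Function.extend e b 0 l = 0 := by
    rw [Function.extend_apply' _ _ _ (fun ⟨t, ht⟩ => ((he l).mp ⟨t, ht⟩).2 rfl)]; rfl
  have hker : g - rename e (killCompl e g) ∈ Ideal.span {(X j : MvPowerSeries (Fin n) κ), X l} := by
    apply ker_killCompl_le e he
    rw [RingHom.mem_ker]
    change killCompl e (g - rename e (killCompl e g)) = 0
    rw [map_sub, killCompl_rename_app, sub_self]
  obtain ⟨c, d, hcd⟩ := Ideal.mem_span_pair.mp hker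
  have hdec : g = rename e (killCompl e g) + (c * X j + d * X l) := by rw [hcd]; ring
  have hXe : HasSubst (X ∘ e : Fin m → MvPowerSeries (Fin n) κ) :=
    hasSubst_of_constantCoeff_zero fun t => constantCoeff_X _
  conv_lhs => rw [hdec]
  rw [subst_add hb', subst_add hb', subst_mul hb', subst_mul hb', subst_X hb', subst_X hb', hj, hl,
    mul_zero, mul_zero, add_zero, add_zero, rename_eq_subst, subst_comp_subst_apply hXe hb']
  congr 1
  funext t
  rw [Function.comp_apply, subst_X hb', e.injective.extend_apply]

/-- An algebra automorphism does not create linear terms: if `G` has no linear terms then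
neither has `F G`. [folklore] -/
theorem coeff_single_algEquiv_eq_zero (F : MvPowerSeries (Fin n) κ ≃ₐ[κ] MvPowerSeries (Fin n) κ)
    {G : MvPowerSeries (Fin n) κ} (hG : ∀ s, coeff (Finsupp.single s 1) G = 0) (t : Fin n) :
    coeff (Finsupp.single t 1) (F G) = 0 := by
  have hsplit : G = C (constantCoeff G) + (G - C (constantCoeff G)) := by ring
  have h2 : 2 ≤ (G - C (constantCoeff G)).order := by
    rw [FormalCoordChange.two_le_order_iff]
    refine ⟨by simp, fun s => ?_⟩
    rw [map_sub, hG s, coeff_C, if_neg (Finsupp.single_ne_zero.mpr one_ne_zero), sub_zero]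
  have h2' := le_order_algEquiv F h2
  have hC : F (C (constantCoeff G)) = C (constantCoeff G) := by
    rw [MvPowerSeries.c_eq_algebraMap]; exact F.commutes _
  rw [hsplit, map_add, map_add, hC, coeff_C, if_neg (Finsupp.single_ne_zero.mpr one_ne_zero), zero_add]
  exact ((FormalCoordChange.two_le_order_iff _).mp h2').2 t

/-- **THE DESCENT STEP** (characteristic two). Let `X_i² G = a∘Φ_{i,τ}` with `ord a ≥ 2`, `G`
without linear terms, and `[X_j X_l] a ≠ 0` for a pair `j ≠ l` avoiding `i`. Then, killing
`X_j, X_l` after the two reductions, one obtains `a', G'` in `n - 2` variables in the same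
relation, with isomorphic Milnor algebras. [folklore] -/
theorem descent_step [CharP κ 2] (i : Fin n) (τ : Fin n → κ) {a G : MvPowerSeries (Fin n) κ}
    (ha : 2 ≤ a.order) (hG0 : ∀ s, coeff (Finsupp.single s 1) G = 0)
    (hG : X i ^ 2 * G = subst (fun s => if s = i then (X i : MvPowerSeries (Fin n) κ)
      else X i * (X s + C (τ s))) a)
    {j l : Fin n} (hjl : j ≠ l) (hj : j ≠ i) (hl : l ≠ i)
    (hq : coeff (Finsupp.single j 1 + Finsupp.single l 1) a ≠ 0)
    (e : Fin m ↪ Fin n) (he : ∀ s, s ∈ Set.range e ↔ s ≠ j ∧ s ≠ l) (i' : Fin m) (hi' : e i' = i) :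
    ∃ a' G' : MvPowerSeries (Fin m) κ, 2 ≤ a'.order ∧ (∀ t, coeff (Finsupp.single t 1) G' = 0) ∧
      X i' ^ 2 * G' = subst (fun t => if t = i' then (X i' : MvPowerSeries (Fin m) κ)
        else X i' * (X t + C (τ (e t)))) a' ∧
      Nonempty ((MvPowerSeries (Fin n) κ ⧸ Ideal.span (Set.range fun s => MvPowerSeries.pderiv s a))
        ≃ₐ[κ] (MvPowerSeries (Fin m) κ ⧸ Ideal.span (Set.range fun t => MvPowerSeries.pderiv t a'))) ∧
      Nonempty ((MvPowerSeries (Fin n) κ ⧸ Ideal.span (Set.range fun s => MvPowerSeries.pderiv s G))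
        ≃ₐ[κ] (MvPowerSeries (Fin m) κ ⧸ Ideal.span (Set.range fun t => MvPowerSeries.pderiv t G'))) := by
  have ha' := (FormalCoordChange.two_le_order_iff a).mp ha
  have hqG : coeff (Finsupp.single j 1 + Finsupp.single l 1) G =
      coeff (Finsupp.single j 1 + Finsupp.single l 1) a := coeff_pair_strict i τ ha hG hjl hj hl
  obtain ⟨F, hθ0, hF, hJ, hdj, hdl, hXj, hXl⟩ := pair_reduction hjl hq (ha'.2 j) (ha'.2 l)
  obtain ⟨F', hθ'0, hF', hJ', hdj', hdl', hXj', hXl'⟩ :=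
    pair_reduction (f := G) hjl (by rw [hqG]; exact hq) (hG0 j) (hG0 l)
  rw [hqG] at hθ'0 hF'
  set q := coeff (Finsupp.single j 1 + Finsupp.single l 1) a with hq'
  set θ : Fin n → MvPowerSeries (Fin n) κ := fun s => if s = j then q⁻¹ • MvPowerSeries.pderiv l a
      else if s = l then q⁻¹ • MvPowerSeries.pderiv j a else X s with hθ
  set θ' : Fin n → MvPowerSeries (Fin n) κ := fun s => if s = j then q⁻¹ • MvPowerSeries.pderiv l G
      else if s = l then q⁻¹ • MvPowerSeries.pderiv j G else X s with hθ'
  have hθsub : HasSubst θ := hasSubst_of_constantCoeff_zero hθ0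
  have hθ'sub : HasSubst θ' := hasSubst_of_constantCoeff_zero hθ'0
  have hΦ := hasSubst_blowFam i τ
  -- the translation vector with the `j`, `l` components zeroed
  set τ' : Fin n → κ := Function.update (Function.update τ j 0) l 0 with hτ'
  have hτ'j : τ' j = 0 := by
    rw [hτ', Function.update_of_ne hjl, Function.update_self]
  have hτ'l : τ' l = 0 := by rw [hτ', Function.update_self]
  have hτ's : ∀ s, s ≠ j → s ≠ l → τ' s = τ s := fun s hsj hsl => by
    rw [hτ', Function.update_of_ne hsl, Function.update_of_ne hsj]
  have hΦ' := hasSubst_blowFam i τ'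
  have hθi : θ i = X i := by simp [hθ, Ne.symm hj, Ne.symm hl]
  have hθ'i : θ' i = X i := by simp [hθ', Ne.symm hj, Ne.symm hl]
  -- STEP A: the two composite substitution families agree
  have hfam : ∀ s, subst (fun s => if s = i then (X i : MvPowerSeries (Fin n) κ)
      else X i * (X s + C (τ s))) (θ s) =
      subst θ' ((fun s => if s = i then (X i : MvPowerSeries (Fin n) κ) else X i * (X s + C (τ' s))) s) := by
    intro s
    by_cases hsj : s = j
    · rw [hsj]
      simp only [hθ, hθ', if_true, if_neg hj, hτ'j, map_zero, add_zero]
      rw [subst_smul hΦ, ← X_mul_pderiv_strict_of_ne i τ hl hG, subst_mul hθ'sub, subst_X hθ'sub,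
        subst_X hθ'sub, hθ'i]
      simp only [hθ', if_true, mul_smul_comm]
    · by_cases hsl : s = l
      · rw [hsl]
        simp only [hθ, hθ', if_neg (Ne.symm hjl), if_true, if_neg hl, hτ'l, map_zero, add_zero]
        rw [subst_smul hΦ, ← X_mul_pderiv_strict_of_ne i τ hj hG, subst_mul hθ'sub, subst_X hθ'sub,
          subst_X hθ'sub, hθ'i]
        simp only [hθ', if_neg (Ne.symm hjl), if_true, mul_smul_comm]
      · have hθs : θ s = X s := by simp [hθ, hsj, hsl]
        have hθ's : θ' s = X s := by simp [hθ', hsj, hsl]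
        rw [hθs, subst_X hΦ]
        by_cases hsi : s = i
        · rw [hsi]; simp only [if_true]; rw [subst_X hθ'sub, hθ'i]
        · simp only [if_neg hsi, hτ's s hsj hsl]
          rw [subst_mul hθ'sub, subst_add hθ'sub, subst_X hθ'sub, subst_X hθ'sub, subst_C,
            hθ'i, hθ's]
  have hcomm : ∀ g, subst (fun s => if s = i then (X i : MvPowerSeries (Fin n) κ)
      else X i * (X s + C (τ s))) (F g) =
      F' (subst (fun s => if s = i then (X i : MvPowerSeries (Fin n) κ) else X i * (X s + C (τ' s))) g) := by
    intro g
    rw [hF, hF', subst_comp_subst_apply hθsub hΦ, subst_comp_subst_apply hΦ' hθ'sub]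
    congr 1
    funext s
    exact hfam s
  -- STEP B: the reduced pair is again a strict-transform pair
  set a1 := F.symm a with ha1
  set G1 := F'.symm G with hG1
  have hFX' : F' (X i) = X i := by rw [hF', subst_X hθ'sub, hθ'i]
  have hB : X i ^ 2 * G1 = subst (fun s => if s = i then (X i : MvPowerSeries (Fin n) κ)
      else X i * (X s + C (τ' s))) a1 := by
    apply F'.injective
    have : a = F a1 := (F.apply_symm_apply a).symm
    rw [map_mul, map_pow, hFX', hG1, F'.apply_symm_apply, hG, this, hcomm]
  -- STEP C: kill `X_j`, `X_l`
  refine ⟨killCompl e a1, killCompl e G1, two_le_order_killCompl e (le_order_algEquiv F.symm ha),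
    fun t => ?_, ?_, descent e he F hJ hdj hdl hXj hXl, descent e he F' hJ' hdj' hdl' hXj' hXl'⟩
  · rw [coeff_single_killCompl]
    exact coeff_single_algEquiv_eq_zero F'.symm hG0 _
  · have hC := congrArg (killCompl e) hB
    rw [map_mul, map_pow, ← hi', killCompl_X, killCompl_subst e (constantCoeff_blowFam (e i') τ')] at hC
    rw [hC, ← subst_extend_eq_subst_killCompl e he _ (constantCoeff_blowFam i' (fun t => τ (e t)))]
    congr 1
    funext s
    by_cases hs : ∃ t, e t = s
    · obtain ⟨t, rfl⟩ := hs
      rw [e.injective.extend_apply]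
      have hne : e t ≠ j ∧ e t ≠ l := (he (e t)).mp ⟨t, rfl⟩
      by_cases hti : t = i'
      · rw [if_pos (congrArg e hti), if_pos hti, killCompl_X]
      · rw [if_neg (fun h => hti (e.injective h)), if_neg hti, map_mul, map_add, killCompl_X,
          killCompl_X, killCompl_C, hτ's _ hne.1 hne.2]
    · rw [Function.extend_apply' _ _ _ hs, Pi.zero_apply]
      have hs' : s = j ∨ s = l := by
        have := (he s).not.mp hs
        tauto
      have hsi : s ≠ e i' := fun h => hs ⟨i', h.symm⟩
      simp only [if_neg hsi, map_mul, map_add, killCompl_C]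
      rw [killCompl_X_eq_zero (fun h => hs h), zero_add]
      rcases hs' with rfl | rfl
      · rw [hτ'j, map_zero, mul_zero]
      · rw [hτ'l, map_zero, mul_zero]

end Step

end MuDropCharTwoOrdP

end Summit.ResolutionOfSingularities.ResolutionOfSingularities.Theorems.WildCones

end
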